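import Mathlib.Algebra.Group.MinimalAxioms
import Mathlib.Tactic.DeriveFintype
import Summits.MatrixMultiplication.OmegaCensus.CentreIndexSixTPP

/-!
# ω-census, family (b3): centre of index `6` — the member `C₃ ⋊ C₈` and its census cells

HONEST FRAMING (pub-omega census; verbatim): lottery ticket; floor = certified bounds/negative ranges.
Census BOOKKEEPING (prereg P-028, item .3, the instance `C₃⋊C₈ × A` named there): the non-split member `C₃ ⋊ C₈` (order `24`,
`Z = ⟨t²⟩ ≅ C₄`, `G/Z ≅ S₃`) of the class `[G : Z(G)] = 6` as a hand-built group type (pairs `(k, γ) ∈ ZMod 3 × ZMod 8`,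
`(k, γ)(k', γ') = (k + (−1)^γ k', γ + γ')`, group axioms checked by `decide` on the `24` elements), its coordinates `Coord` (by `decide`),
hence by `CentreIndexSixTPP.lean` the law "no `⟨N, 3, 3⟩` in `(C₃ ⋊ C₈) × A`, `A` finite abelian, in any order, when `120|A| < 27N`" and
the cells `(9, 3, 3) ∉ (C₃ ⋊ C₈) × C₂` (order `48`, `243 > 240`), `(14, 3, 3) ∉ (C₃ ⋊ C₈) × C₃` (order `72`, `378 > 360`).
A certified NEGATIVE RANGE for single TPP triples; nothing here is progress on `ω`.
-/

namespace Summit.MatrixMultiplication.OmegaCensus.CentreIndexSix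

/-- The group `C₃ ⋊ C₈ = ⟨c, t | c³ = t⁸ = 1, t c t⁻¹ = c⁻¹⟩` (order `24`, centre `⟨t²⟩` of index `6`, not a product `Q × A` with
`|Q| < 24`): elements `c^k t^γ` as pairs `(k, γ) ∈ ZMod 3 × ZMod 8`. [folklore] -/
structure C3sdC8 where
  /-- exponent of `c` -/
  k : ZMod 3
  /-- exponent of `t` -/
  γ : ZMod 8
  deriving DecidableEq, Fintype

namespace C3sdC8

/-- The sign by which `t^γ` acts on `⟨c⟩`: `(−1)^γ`. [folklore] -/
def sgn (γ : ZMod 8) : ZMod 3 := if γ.val % 2 = 0 then 1 else -1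

/-- Twisted product `(k, γ)(k', γ') = (k + (−1)^γ k', γ + γ')`. [folklore] -/
instance : Mul C3sdC8 := ⟨fun a b => ⟨a.k + sgn a.γ * b.k, a.γ + b.γ⟩⟩

/-- Identity `(0, 0)`. [folklore] -/
instance : One C3sdC8 := ⟨⟨0, 0⟩⟩

/-- Inverse `(k, γ)⁻¹ = (−(−1)^γ k, −γ)`. [folklore] -/
instance : Inv C3sdC8 := ⟨fun a => ⟨-(sgn a.γ * a.k), -a.γ⟩⟩

/-- `(k, γ)(k', γ') = (k + (−1)^γ k', γ + γ')`. [folklore] -/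
theorem mul_def (a b : C3sdC8) : a * b = ⟨a.k + sgn a.γ * b.k, a.γ + b.γ⟩ := rfl

/-- `C₃ ⋊ C₈` is a group (axioms checked on the `24` elements). [folklore] -/
instance : Group C3sdC8 :=
  Group.ofLeftAxioms (by decide +kernel) (by decide +kernel) (by decide +kernel)

/-- Coordinate `κ (k, γ) = k`. [folklore] -/
def κS (a : C3sdC8) : ZMod 3 := a.k

/-- Sign `ε (k, γ) = (−1)^γ`. [folklore] -/
def εS (a : C3sdC8) : ZMod 3 := sgn a.γ

/-- `C₃ ⋊ C₈` has coordinates (`c = (1, 0)`). [folklore] -/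
theorem coord_C3sdC8 : Coord (⟨1, 0⟩ : C3sdC8) κS εS := by
  unfold Coord; decide +kernel

end C3sdC8

/-- **Law for `(C₃ ⋊ C₈) × A`** (`A` finite abelian): no `⟨N, 3, 3⟩` in any order when `120|A| < 27N`. [folklore] -/
theorem C3sdC8_prod_no_tpp_three_three {A : Type*} [CommGroup A] [Fintype A] [DecidableEq A] (N : ℕ)
    (hlt : 120 * Fintype.card A < 27 * N) :
    ¬ Literature.Computability.AlgebraicComplexity.RealizesTPP (C3sdC8 × A) N 3 3 ∧
      ¬ Literature.Computability.AlgebraicComplexity.RealizesTPP (C3sdC8 × A) 3 N 3 ∧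
        ¬ Literature.Computability.AlgebraicComplexity.RealizesTPP (C3sdC8 × A) 3 3 N :=
  C3sdC8.coord_C3sdC8.prod.not_realizesTPP_three_three N
    (by rw [Fintype.card_prod, show Fintype.card C3sdC8 = 24 by rfl]; omega)

/-- Census cell `(9, 3, 3)` at order `48` in `(C₃ ⋊ C₈) × C₂` (`27·9 = 243 > 240 = 5·48`): not realized, in any order. [folklore] -/
theorem C3sdC8xC2_no_tpp_9_3_3 :
    ¬ Literature.Computability.AlgebraicComplexity.RealizesTPP (C3sdC8 × Multiplicative (ZMod 2)) 9 3 3 ∧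
      ¬ Literature.Computability.AlgebraicComplexity.RealizesTPP (C3sdC8 × Multiplicative (ZMod 2)) 3 9 3 ∧
        ¬ Literature.Computability.AlgebraicComplexity.RealizesTPP (C3sdC8 × Multiplicative (ZMod 2)) 3 3 9 :=
  C3sdC8_prod_no_tpp_three_three 9 (by simp)

/-- Census cell `(14, 3, 3)` at order `72` in `(C₃ ⋊ C₈) × C₃` (`27·14 = 378 > 360 = 5·72`): not realized, in any order. [folklore] -/
theorem C3sdC8xC3_no_tpp_14_3_3 :
    ¬ Literature.Computability.AlgebraicComplexity.RealizesTPP (C3sdC8 × Multiplicative (ZMod 3)) 14 3 3 ∧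
      ¬ Literature.Computability.AlgebraicComplexity.RealizesTPP (C3sdC8 × Multiplicative (ZMod 3)) 3 14 3 ∧
        ¬ Literature.Computability.AlgebraicComplexity.RealizesTPP (C3sdC8 × Multiplicative (ZMod 3)) 3 3 14 :=
  C3sdC8_prod_no_tpp_three_three 14 (by simp)

end Summit.MatrixMultiplication.OmegaCensus.CentreIndexSix
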